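import Literature.GroupTheory.CombinatorialGroupTheory.PuncturedSurfaceGroupFiniteIndex
import Literature.GroupTheory.CombinatorialGroupTheory.SurfaceGroupFiniteIndexSubgroupHolds
import Literature.AnabelianGeometry.SemiGraphs.ProSigmaSurfaceCharacters
import HarnessLib

/-!
# Finite-index subgroups of punctured surface groups: the closed case `r = 0`

Topic `Literature/GroupTheory/CombinatorialGroupTheory`.  The named fact
`PuncturedSurfaceGroupFiniteIndexSubgroup` (Hoare–Karrass–Solitar; Zieschang–Vogt–Coldewey
Thm 4.14.1 / §4.14, file `PuncturedSurfaceGroupFiniteIndex.lean`) quantifies over ALL hyperbolic types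
`(g, r)`, including the closed surfaces `r = 0` (`g ≥ 2`).  In that case `Γ_{g,0}` is the surface
group `S_g` (`IsProSigmaCompletion.nonempty_mulEquiv_puncturedSurfaceGroup_zero` of
`ProSigmaSurfaceCharacters.lean`: the two presentations differ only by the empty family of puncture
generators), there are no cusps, and the statement reduces to the Riemann–Hurwitz fact for closed
surface groups, `SurfaceGroupFiniteIndexSubgroup`, which is a THEOREM of the tree
(`surfaceGroupFiniteIndexSubgroup_holds`, seat abc-iut-L5-d3).  We record the resulting unconditional
`r = 0` clause (`finiteIndexSubgroup_zero`).  Theorems only.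

## References

* H. Zieschang, E. Vogt, H.-D. Coldewey, *Surfaces and Planar Discontinuous Groups*, LNM 835,
  Springer 1980, Thm 4.14.22 / Prop 4.14.23, §4.14. [ZieschangVogtColdewey1980]
-/

namespace Literature.GroupTheory.CombinatorialGroupTheory.PuncturedSurfaceGroup

open Literature.Topology.FourManifolds Function
open Literature.AnabelianGeometry.SemiGraphs.SemiGraphOfAnabelioids (IsProSigmaCompletion.nonempty_mulEquiv_puncturedSurfaceGroup_zero)

/-- **The closed case of `PuncturedSurfaceGroupFiniteIndexSubgroup`, unconditionally**: for `g ≥ 2`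
(`2 < 2g + 0`) and `K ≤ Γ_{g,0}` of finite index `d`, `K ≅ Γ_{g',0}` with `2g' + 2d = 2dg + 2`
(Riemann–Hurwitz), via `Γ_{g,0} ≅ S_g` and the tree's theorem `surfaceGroupFiniteIndexSubgroup_holds`
(seat abc-iut-L5-d3);
the cusp clauses are vacuous. [cite: ZieschangVogtColdewey1980, Thm 4.14.22 / Prop 4.14.23 p.154] -/
theorem finiteIndexSubgroup_zero (g : ℕ) (hg : IsHyperbolicType g 0)
    (K : Subgroup (PuncturedSurfaceGroup g 0)) [K.FiniteIndex] :
    ∃ (g' r' : ℕ) (θ : PuncturedSurfaceGroup g' r' →* PuncturedSurfaceGroup g 0)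
      (cusp : Fin r' → Fin 0) (rep : Fin r' → PuncturedSurfaceGroup g 0),
      IsHyperbolicType g' r' ∧ Injective θ ∧ θ.range = K ∧
      2 * g' + r' + 2 * K.index = K.index * (2 * g + 0) + 2 ∧
      (∀ j' : Fin r', (cuspInertia j').map θ = peripheralSubgroup K (cusp j') (rep j')) ∧
      ∀ (j : Fin 0) (γ : PuncturedSurfaceGroup g 0), ∃! j' : Fin r', cusp j' = j ∧
        ∃ k ∈ K, ∃ z ∈ cuspInertia j, rep j' = k * γ * z := by
  have hg2 : 2 ≤ g := by unfold IsHyperbolicType at hg; omega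
  obtain ⟨e⟩ := IsProSigmaCompletion.nonempty_mulEquiv_puncturedSurfaceGroup_zero g
  -- transport `K` to `S_g`
  let K' : Subgroup (SurfaceGroup g) := K.map (e : PuncturedSurfaceGroup g 0 →* SurfaceGroup g)
  have hidx : K'.index = K.index := Subgroup.index_map_equiv K e
  haveI : K'.FiniteIndex := ⟨by rw [hidx]; exact Subgroup.FiniteIndex.index_ne_zero⟩
  obtain ⟨h, hh, ⟨ψ⟩⟩ := surfaceGroupFiniteIndexSubgroup_holds g hg2 K' inferInstance
  obtain ⟨e'⟩ := IsProSigmaCompletion.nonempty_mulEquiv_puncturedSurfaceGroup_zero h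
  -- `θ : Γ_{h,0} ≅ S_h ≅ K' ↪ S_g ≅ Γ_{g,0}`
  let θ : PuncturedSurfaceGroup h 0 →* PuncturedSurfaceGroup g 0 :=
    ((e.symm : SurfaceGroup g →* PuncturedSurfaceGroup g 0).comp K'.subtype).comp
      (ψ.symm.toMonoidHom.comp e'.toMonoidHom)
  refine ⟨h, 0, θ, Fin.elim0, Fin.elim0, ?_, ?_, ?_, ?_, fun j' => Fin.elim0 j', fun j => Fin.elim0 j⟩
  · unfold IsHyperbolicType
    have := two_le_genus_of_index hg2 (Subgroup.FiniteIndex.index_ne_zero) hh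
    omega
  · exact (e.symm.injective.comp Subtype.val_injective).comp (ψ.symm.injective.comp e'.injective)
  · ext x
    constructor
    · rintro ⟨y, rfl⟩
      change e.symm ((ψ.symm (e' y) : SurfaceGroup g)) ∈ K
      obtain ⟨k0, hk0, hk0e⟩ := (ψ.symm (e' y)).2
      rw [← hk0e]
      simpa using hk0
    · intro hx
      refine ⟨e'.symm (ψ ⟨e x, ⟨x, hx, rfl⟩⟩), ?_⟩
      simp [θ]
  · rw [← hidx, hh]
    have h1 : 1 ≤ g := by omega
    zify [h1]
    ring

end Literature.GroupTheory.CombinatorialGroupTheory.PuncturedSurfaceGroup
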